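import Literature.NumberTheory.EllipticCurves.HeegnerPointsKolyvaginExceptionalProofs
import Literature.NumberTheory.EllipticCurves.HeegnerPointsKolyvaginPrimaryLeavesProofs
import HarnessLib

/-!
# Kolyvagin's theorem in the CM / `d_K ∈ {-3, -4}` cases, III: the leaf from Kolyvagin's descent data modulo `p^M`

Third sibling proof file (theorems only, nothing is defined, no named fact is introduced) for the
named fact `Literature.NumberTheory.EllipticCurves.Kolyvagin1990_thmA_of_hasCM_or_discr N W K` of
`HeegnerPointsKolyvaginProofs` — Kolyvagin's Theorem A (*"Suppose `y_K` has infinite order. Then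
`E(K)` has rank `1` and `Ш(E/K)` is finite"*, W. G. McCallum, *Kolyvagin's work on
Shafarevich–Tate groups*, LMS Lecture Note Ser. 153 (1991), §1, PDF p. 277 of the held volume,
stated there for `R = End(E)` arbitrary and every `K` with the Heegner hypothesis) in the cases
that B. H. Gross's exposition in the same volume sets aside (`E` with CM, §2; `d_K ∈ {-3, -4}`,
§1).

The first two sibling files reduced the leaf to Gross's Prop. 2.3 at almost all primes
(`Kolyvagin1990_thmA_of_hasCM_or_discr_of_card_selmerGroup`, `…_of_localData`) **and to the
tree's `p`-primary leaf `Kolyvagin1990_sha_primary_finite`**. Since then the tree has acquired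
Kolyvagin's descent *modulo `p^M`* as abstract data `KolyvaginDescent.HypothesesM` with its
annihilation theorem `p^{2M₀} Sel_{p^M}(E/K) ⊆ ℤ δ_M x₀` (`HeegnerPointsKolyvaginPrimaryDescentProofs`),
the passage to `Ш(E/K)[p^∞]` (`finite_sha_primary_of_hypothesesM_of_le`) and the construction
of these data from the two mod-`p^M` Euler-system leaves (`exists_hypothesesM_of_leavesM`,
`HeegnerPointsKolyvaginPrimaryLeavesProofs`) — and that file discharges the CM / `d_K ∈ {-3, -4}`
part of the `p`-primary leaf *from the present leaf*
(`Kolyvagin1990_sha_primary_finite_of_leavesM_of_thmA`). To keep the dependency graph acyclic,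
this file re-routes the present leaf **directly onto Kolyvagin's per-prime descent data, with no
reference to `Kolyvagin1990_sha_primary_finite`**:

* `KolyvaginDescent.HypothesesM.natCard_sel_of_M_eq_one` — at level `M = 1` with `M₀ = 0`
  (`p ∤ [E(K) : ℤ y_K]`) the annihilation theorem reads `Sel_p(E/K) = ℤ δ y_K`, of order `p`:
  Gross's Prop. 2.3 is the case `M = 1`, `M₀ = 0` of McCallum's §5.
* `WeierstrassCurve.mordellWeilRank_eq_one_and_shaFinite_of_hypothesesM` — for any elliptic
  curve over a number field and `P` of infinite order: descent data on `H¹(K, E[p^j])` for all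
  `j ≥ 1` (with `Sel = Sel^{(p^j)}`, `x ∈ δ(E(K))`, a common `M₀` and `p^{M₀} x₀ = P`) at every
  prime off a finite *residual* set, together with the finiteness of `Ш[p^∞]` at the residual
  primes, give `rank E(K) = 1` and `Ш(E/K)` finite. (Level `1` at the large primes `p ∤ P` gives
  Prop. 2.3, hence Prop. 2.1 by the first sibling file; all levels give `Ш[p^∞]` finite; then
  `shaFinite_of_primary`.)
* `Kolyvagin1990_thmA_of_hasCM_or_discr_of_hypothesesM` — the leaf from such data for the Heegner
  point in the excluded cases (the CM-capable interface: no hypothesis on `End(E)`, `d_K` or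
  `ρ̄_{E,p}`).
* `KolyvaginDescent.exists_hypothesesM_of_localDataM` — the data `HypothesesM` on
  `H¹(K, E[p^M])` from the *bodies* of the two mod-`p^M` leaves (A), (B) of
  `exists_hypothesesM_of_leavesM` and of McCallum's Cor. 3.2 at level `p^M` (C), for **any**
  elliptic `E/ℚ`, imaginary quadratic `K`, odd `p` with `E(K)[p] = 0` — the hypothesis
  "`ρ̄_{E,p}` onto" of `exists_hypothesesM_of_leavesM` (never satisfied by a CM curve at large `p`)
  is used there only for `E(K)[p] = 0` and for (C), and is replaced by them here;
  `Kolyvagin1990_thmA_of_hasCM_or_discr_of_localDataM` — the leaf from (A), (B), (C) at the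
  non-residual primes and [K1] at the residual ones (the form a proof of the CM case must take:
  (C) for the image `Aut_R(E_p)`, McCallum §1, is not in the tree).
* `Kolyvagin1990_thmA_of_hasCM_or_discr_of_leavesM_of_not_hasCM` — **the sub-case `E` without
  CM, `d_K ∈ {-3, -4}`, from exactly the inputs of the main case**: Serre's open image theorem,
  the Čebotarev density theorem and the Weil pairing (named facts of the tree), the two
  mod-`p^M` leaves (A), (B) *in the verbatim shape of the hypothesis `hleaves` of
  `Kolyvagin1990_sha_primary_finite_of_leavesM`* but for `d_K ∈ {-3, -4}` and `p ∤ 2d_K`, and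
  Kolyvagin's [K1] for the residual primes `p ∣ 2d_K` or `ρ̄_{E,p}` not onto. McCallum's Cor. 3.2
  is a theorem at every level here (`McCallum1991_cor_3_2_pow_of_chebotarev`). The primes
  `p ∣ 2d_K` are residual because `u_K = #𝒪_K^×/2 ∈ {3, 2}` equals `p` there: the Galois group
  `G_ℓ = Gal(K_ℓ/K_1)` of the ring class field has order `(ℓ + 1)/u_K` (Gross 1991, §3, with
  `𝒪_K^× ≠ {±1}`), so Kolyvagin's derivative operator needs `p^M ∣ (ℓ + 1)/u_K`, which the
  level-`p^M` Frobenius condition supplies only for `p ∤ u_K`.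

## State of the leaf after this file

`Kolyvagin1990_thmA_of_hasCM_or_discr` ⇐ (¬CM, `d_K ∈ {-3, -4}`) `serre_open_image`,
`chebotarev_artinRep`, `exists_weilPairing` + leaves (A), (B) modulo `p^M` for `p ∤ 2d_K` with
`ρ̄_{E,p}` onto + `Ш(E/K)[p^∞]` finite for `p ∣ 2d_K` or `ρ̄_{E,p}` not onto [K1]; (CM) leaves
(A), (B), (C) modulo `p^M` off a finite residual set of primes + `Ш(E/K)[p^∞]` finite on it [K1].
None of (A), (B), (C)-for-CM is in the tree at any level (CM points of conductor `n` on `X₀(N)`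
and the Euler-system relations; local Tate duality; the image `Aut_R(E_p)` of a CM curve);
Kolyvagin 1990 [K1] is cite-only.

## References

* W. G. McCallum, *Kolyvagin's work on Shafarevich–Tate groups*, in *`L`-functions and arithmetic
  (Durham, 1989)*, LMS Lecture Note Ser. 153, CUP (1991), 295–316: §1 Theorem (Kolyvagin), §3
  Cor. 3.2, §4 ((6), Lemma 4.3, Prop. 4.4), §5 (Lemmas 5.1, 5.3) (held
  `book:editornd-l-functions-arithmetic`, PDF pp. 276–286). [McCallumLMS1991]
* B. H. Gross, *Kolyvagin's work on modular elliptic curves*, same volume, 235–256: §1 (D ≠ 3, 4;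
  Thm. 1.3), §2 (Props. 2.1, 2.3 and the two paragraphs following Prop. 2.1), §3 (the order of
  `G_ℓ`), Props. 5.3, 5.4 (PDF pp. 212–215, 216, 220). [GrossLMS1991]
* V. A. Kolyvagin, *Euler systems*, in *The Grothendieck Festschrift II*, Progr. Math. 87 (1990),
  435–483, Thm. A. [Kolyvagin1990] (cite only; not held.)
* J.-P. Serre, *Propriétés galoisiennes des points d'ordre fini des courbes elliptiques*, Invent.
  Math. 15 (1972), §4.2 Thm. 2 (through `serre_open_image`). [Serre1972]
-/

noncomputable section

open scoped Classical
open WeierstrassCurve NumberField IsDedekindDomain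
open Literature.NumberTheory.GaloisRepresentations

universe u v

namespace Literature.NumberTheory.EllipticCurves

/-! ## Level `1`, `M₀ = 0`: Gross's Prop. 2.3 from the annihilation theorem -/

namespace KolyvaginDescent

namespace HypothesesM

variable {V : Type*} [AddCommGroup V] {Pl : Type*} (S : HypothesesM V Pl)

/-- With `M₀ = 0` (`p ∤ [E(K) : ℤ y_K]`) the annihilation theorem
`p^{2M₀} Sel ⊆ ℤ x` (`pow_zsmul_mem_zmultiples`) reads `Sel ⊆ ℤ x`.
[cite: McCallumLMS1991, §1 Theorem (Kolyvagin) and §5] [cite: GrossLMS1991, Prop. 2.3] -/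
theorem sel_le_zmultiples_of_M₀_eq_zero (h0 : S.M₀ = 0) : S.Sel ≤ AddSubgroup.zmultiples S.x := by
  intro s hs
  have h := S.pow_zsmul_mem_zmultiples hs
  rwa [h0, mul_zero, pow_zero, one_smul] at h

/-- With `M₀ = 0`, `Sel = ℤ x` (as `x ∈ Sel`). [cite: GrossLMS1991, Prop. 2.3] -/
theorem sel_eq_zmultiples_of_M₀_eq_zero (h0 : S.M₀ = 0) : S.Sel = AddSubgroup.zmultiples S.x :=
  le_antisymm (S.sel_le_zmultiples_of_M₀_eq_zero h0) (AddSubgroup.zmultiples_le_of_mem S.x_mem)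

/-- At level `M = 1` the class `x` has order exactly `p` (`p x = 0` as `V` is killed by `p`,
`x ≠ 0` by `x_ord`). [folklore] -/
theorem addOrderOf_x_of_M_eq_one (hM : S.M = 1) : addOrderOf S.x = S.p := by
  haveI : Fact S.p.Prime := ⟨S.hp⟩
  refine addOrderOf_eq_prime ?_ ?_
  · have h := S.torsion S.x
    rwa [hM, pow_one, natCast_zsmul] at h
  · have h := S.x_ord
    rwa [hM, Nat.sub_self, pow_zero, one_smul] at h

/-- **Gross's Prop. 2.3 as the case `M = 1`, `M₀ = 0` of Kolyvagin's descent modulo `p^M`**: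
`#Sel = p` (indeed `Sel = ℤ x` with `x` of order `p`). In the application
(`V = H¹(K, E_p)`, `x = δ y_K`, `p ∤ y_K`) this is `Sel(E/K)_p = ℤ δ y_K ≅ ℤ/p`.
[cite: GrossLMS1991, Prop. 2.3] [cite: McCallumLMS1991, §1 Theorem (Kolyvagin), §5] -/
theorem natCard_sel_of_M_eq_one (hM : S.M = 1) (h0 : S.M₀ = 0) : Nat.card S.Sel = S.p := by
  rw [S.sel_eq_zmultiples_of_M₀_eq_zero h0, Nat.card_zmultiples, S.addOrderOf_x_of_M_eq_one hM]

end HypothesesM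

end KolyvaginDescent

end Literature.NumberTheory.EllipticCurves

/-! ## Theorem A from descent data at every level, for an elliptic curve over a number field -/

namespace WeierstrassCurve

open Literature.NumberTheory.EllipticCurves Literature.NumberTheory.EllipticCurves.KolyvaginDescent

variable {F : Type u} [Field F] [NumberField F] (V : WeierstrassCurve F)

/-- **Rank one and finiteness of `Ш` from Kolyvagin's descent data modulo `p^M` at almost all
primes and the finiteness of `Ш[p^∞]` at the others.** Let `E` be an elliptic curve over a
number field `K`, `P ∈ E(K)` of infinite order, and `R` a set of primes that is finite (empty
beyond `B`): the *residual* primes. Suppose that for every prime `p ∉ R` there are `M₀`,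
`x₀ ∈ E(K)` with `p^{M₀} x₀ = P` and, for every `j ≥ 1`, descent data `HypothesesM` on
`H¹(K, E[p^j])` at the prime `p` and level `j` with this `M₀`, `Sel = Sel^{(p^j)}(E/K)` and
`x ∈ ker(H¹(K, E[p^j]) → H¹(K, E)) = δ(E(K))` (McCallum 1991, §5, for all `M`); and that
`Ш(E/K)[p^∞]` is finite for every `p ∈ R`. Then `rank E(K) = 1` and `Ш(E/K)` is finite.
Proof: for a prime `p ≥ B` with `p ∤ P` one has `M₀ = 0`, so the level-`1` data give
`#Sel^{(p)}(E/K) = p` (`HypothesesM.natCard_sel_of_M_eq_one`, Gross's Prop. 2.3), whence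
`rank E(K) = 1` and `Ш[p] = 0` for almost all `p`
(`mordellWeilRank_eq_one_and_sha_cofinite_of_card_selmerGroup`, Gross's Prop. 2.1 at almost all
`p`); for every `p ∉ R` the data at all levels give `p^{2M₀} Ш[p^∞] = 0`, finite
(`finite_sha_primary_of_hypothesesM_of_le`); with the residual primes, `Ш` is finite prime by
prime (`shaFinite_of_primary`). [cite: GrossLMS1991, §1 Thm. 1.3, §2 (Props. 2.1, 2.3)]
[cite: McCallumLMS1991, §1 Theorem (Kolyvagin), §5] -/
theorem mordellWeilRank_eq_one_and_shaFinite_of_hypothesesM [V.IsElliptic]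
    {P : V.toAffine.Point} (hnt : ¬ IsOfFinAddOrder P) {Pl : Type v} {R : ℕ → Prop}
    (hR : ∃ B : ℕ, ∀ p : ℕ, p.Prime → B ≤ p → ¬ R p)
    (hdata : ∀ p : ℕ, p.Prime → ¬ R p →
      ∃ (M₀ : ℕ) (x₀ : V.toAffine.Point)
        (T : ∀ j : ℕ, 1 ≤ j → HypothesesM (V.galH1Torsion ((p ^ j : ℕ) : ℤ)) Pl),
        p ^ M₀ • x₀ = P ∧ ∀ (j : ℕ) (hj : 1 ≤ j), (T j hj).p = p ∧ (T j hj).M₀ = M₀ ∧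
          (T j hj).M = j ∧ (T j hj).Sel = V.selmerGroup ((p ^ j : ℕ) : ℤ) ∧
          (T j hj).x ∈ (V.torsionH1ToH1 ((p ^ j : ℕ) : ℤ)).ker)
    (hres : ∀ p : ℕ, p.Prime → R p → Set.Finite {c : V.sha | ∃ j : ℕ, p ^ j • c = 0}) :
    V.mordellWeilRank = 1 ∧ V.ShaFinite := by
  obtain ⟨B, hB⟩ := hR
  -- Prop. 2.3 at almost all primes: `#Sel^{(p)} = p` for `p ≥ B` prime with `p ∤ P`
  have h23 : ∃ p₀ : ℕ, ∀ p : ℕ, p.Prime → p₀ ≤ p → (¬ ∃ Q : V.toAffine.Point, p • Q = P) →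
      Nat.card (V.selmerGroup p) = p := by
    refine ⟨B, fun p hp hle hndiv ↦ ?_⟩
    obtain ⟨M₀, x₀, T, hx₀, hT⟩ := hdata p hp (hB p hp hle)
    -- `M₀ = 0` since `p ∤ P`
    have hM₀ : M₀ = 0 := by
      by_contra h
      obtain ⟨m, rfl⟩ := Nat.exists_eq_succ_of_ne_zero h
      refine hndiv ⟨p ^ m • x₀, ?_⟩
      rw [← mul_smul, ← pow_succ']
      exact hx₀
    obtain ⟨hTp, hTM₀, hTM, hTSel, -⟩ := hT 1 le_rfl
    have hcard := (T 1 le_rfl).natCard_sel_of_M_eq_one hTM (hTM₀.trans hM₀)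
    rw [hTSel, hTp, pow_one] at hcard
    exact hcard
  obtain ⟨hr, hcof⟩ := V.mordellWeilRank_eq_one_and_sha_cofinite_of_card_selmerGroup hnt h23
  refine ⟨hr, V.shaFinite_of_primary (fun p hp ↦ ?_) hcof⟩
  by_cases hRp : R p
  · exact hres p hp hRp
  · obtain ⟨M₀, x₀, T, -, hT⟩ := hdata p hp hRp
    exact finite_sha_primary_of_hypothesesM_of_le V hp M₀ 1 T (fun j hj ↦ (hT j hj).1)
      (fun j hj ↦ (hT j hj).2.1) (fun j hj ↦ (hT j hj).2.2.2.1) (fun j hj ↦ (hT j hj).2.2.2.2)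

end WeierstrassCurve

namespace Literature.NumberTheory.EllipticCurves

open KolyvaginDescent

/-! ## The data modulo `p^M` from the per-prime bodies, without hypothesis on `ρ̄_{E,p}` (CM-capable) -/

namespace KolyvaginDescent

section LocalDataM

variable {N : ℕ} {W : WeierstrassCurve ℚ} {K : Type u} [Field K] [NumberField K]

/-- **The data of Kolyvagin's descent modulo `p^M` from the per-prime bodies, for any
elliptic `E/ℚ` and imaginary quadratic `K`** — the hypothesis-free core of
`exists_hypothesesM_of_leavesM` (same file of the tree, `HeegnerPointsKolyvaginPrimaryLeavesProofs`),
of which this is a copy with two changes: the hypothesis "`ρ̄_{E,p}` onto" is used there only (i)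
for `E(K)[p] = 0` (`torsionBy_eq_bot_of_isImaginaryQuadratic`) and (ii) to prove McCallum's
Cor. 3.2 at level `p^M` (`McCallum1991_cor_3_2_pow_of_chebotarev`, with the Čebotarev density
theorem and the Weil pairing); here (i) is the hypothesis `hA` and (ii) the hypothesis `hceb`
(the `cebotarev` field as a statement about `H¹(K, E[p^M])`, the Kolyvagin primes of level `M`
and the local conditions at `λ`), so that **no hypothesis on `End(E)`, `d_K` or the image of
`ρ_{E,p}` remains** — the form needed when `E` has complex multiplication, where `ρ̄_{E,p}` is
onto for no large `p` and Cor. 3.2 must be proved for the image `Aut_R(E_p)` (McCallum 1991, §1: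
*"`p` … unramified in `F` and such that `Gal(F(E_p)/F) = Aut_R(E_p)`"*; §3: *"The general case is
not significantly more difficult"*). Inputs otherwise as there: `p` odd, `c` the complex
conjugation (`c² = 1`), `M₀`, `x₀` with `p^{M₀} x₀ = P`, `δ_M P = p^{M₀} δ_M x₀`,
`p^{M-1} δ_M x₀ ≠ 0` (McCallum Lemma 5.1), the sign `ε` with `c P - ε P` torsion (Gross
Prop. 5.3), leaf **(A)** (Kolyvagin's classes `c_M(n)` with McCallum's (6) at `n = 1`,
Lemma 4.3, Prop. 4.4, Gross's Prop. 5.4 (2)) and leaf **(B)** (McCallum's Lemma 5.3 with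
Prop. 2.2). Output: `HypothesesM` on `H¹(K, E[p^M])` with `Sel = S_{p^M}(E/K)`, `x = δ_M x₀`,
the given `p`, `M₀`, `M`. Proof verbatim as there.
[cite: McCallumLMS1991, §1 Theorem (Kolyvagin), §3 Cor. 3.2, §4 (6), Lemma 4.3, Prop. 4.4; §5 Lemma 5.1, Lemma 5.3]
[cite: GrossLMS1991, Props. 5.3, 5.4 (2)] -/
theorem exists_hypothesesM_of_localDataM [W.IsElliptic] (hK : IsImaginaryQuadratic K)
    {P : (W.baseChange K).toAffine.Point} {p : ℕ} (hp : p.Prime) (hp2 : p ≠ 2)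
    (hA : ∀ a : (W.baseChange K).toAffine.Point, p • a = 0 → a = 0) {M : ℕ}
    (hdiv : ∀ Q : geomPoints (W.baseChange K), ∃ R, ((p ^ M : ℕ) : ℤ) • R = Q)
    {c : K ≃ₐ[ℚ] K} (hcc : c * c = 1)
    {M₀ : ℕ} {x₀ : (W.baseChange K).toAffine.Point} (hx₀ : p ^ M₀ • x₀ = P)
    (hPx : kummerMapTorsion (W.baseChange K) _ hdiv P =
      ((p : ℤ) ^ M₀) • kummerMapTorsion (W.baseChange K) _ hdiv x₀)
    (hxord : ((p : ℤ) ^ (M - 1)) • kummerMapTorsion (W.baseChange K) _ hdiv x₀ ≠ 0)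
    (ε : ℤ) (hε : ε = 1 ∨ ε = -1)
    (h53 : IsOfFinAddOrder (Affine.Point.map (W' := W) (c : K →ₐ[ℚ] K) P - ε • P))
    (cl : ℕ → galH1Torsion (W.baseChange K) ((p ^ M : ℕ) : ℤ))
    (hc1 : cl 1 = kummerMapTorsion (W.baseChange K) _ hdiv P)
    (hcl : ∀ m : ℕ, Squarefree m →
      (∀ q ∈ m.primeFactors, IsKolyvaginPrime N W K p q ∧ FrobEqFrobInfty W K (p ^ M) q) →
      conjAct W c _ (cl m) = (ε * (-1) ^ m.primeFactors.card) • cl m ∧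
      (∀ v : HeightOneSpectrum (𝓞 K), (m : 𝓞 K) ∉ v.asIdeal →
        cl m ∈ selmerLocalKer (W.baseChange K) (v.adicCompletion K) ((p ^ M : ℕ) : ℤ)) ∧
      (∀ ℓ : ℕ, ℓ.Prime → ℓ ∣ m → ∀ v : HeightOneSpectrum (𝓞 K), (ℓ : 𝓞 K) ∈ v.asIdeal →
        ∀ a : ℕ, (((p : ℤ) ^ a) • cl m ∈
            selmerLocalKer (W.baseChange K) (v.adicCompletion K) ((p ^ M : ℕ) : ℤ) ↔
          ((p : ℤ) ^ a) • cl (m / ℓ) ∈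
            (W.baseChange K).torsionLocalKer (v.adicCompletion K) ((p ^ M : ℕ) : ℤ))))
    (hdual : ∀ ℓ : ℕ, IsKolyvaginPrime N W K p ℓ ∧ FrobEqFrobInfty W K (p ^ M) ℓ →
      ∀ ν : ℤ, (ν = 1 ∨ ν = -1) → ∀ d : galH1Torsion (W.baseChange K) ((p ^ M : ℕ) : ℤ),
      conjAct W c _ d = ν • d →
      (∀ v : HeightOneSpectrum (𝓞 K), (ℓ : 𝓞 K) ∉ v.asIdeal →
        d ∈ selmerLocalKer (W.baseChange K) (v.adicCompletion K) ((p ^ M : ℕ) : ℤ)) →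
      (∀ w : InfinitePlace K, d ∈ selmerLocalKer (W.baseChange K) w.Completion ((p ^ M : ℕ) : ℤ)) →
      ∀ s ∈ selmerGroup (W.baseChange K) ((p ^ M : ℕ) : ℤ), conjAct W c _ s = ν • s →
      ∀ a : ℕ, a < M → ∀ v : HeightOneSpectrum (𝓞 K), (ℓ : 𝓞 K) ∈ v.asIdeal →
        ((p : ℤ) ^ a) • d ∉ selmerLocalKer (W.baseChange K) (v.adicCompletion K) ((p ^ M : ℕ) : ℤ) →
        ((p : ℤ) ^ (M - 1 - a)) • s ∈
          (W.baseChange K).torsionLocalKer (v.adicCompletion K) ((p ^ M : ℕ) : ℤ))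
    (hceb : ∀ (r : ℕ) (cs : Fin r → galH1Torsion (W.baseChange K) ((p ^ M : ℕ) : ℤ))
      (Nv : Fin r → ℕ), (∀ i, cs i ≠ 0) →
      (∀ i, Nv i ≠ 0 → ((p : ℤ) ^ (Nv i - 1)) • cs i ≠ 0) →
      (∀ i, ∃ e : ℤ, (e = 1 ∨ e = -1) ∧ conjAct W c ((p ^ M : ℕ) : ℤ) (cs i) = e • cs i) →
      (∀ a : Fin r → ℤ, ∑ i, a i • cs i = 0 → ∀ i, a i • cs i = 0) →
      ∀ b : ℕ, ∃ ℓ : ℕ, b < ℓ ∧ IsKolyvaginPrime N W K p ℓ ∧ FrobEqFrobInfty W K (p ^ M) ℓ ∧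
        ∀ i, ∀ v : HeightOneSpectrum (𝓞 K), (ℓ : 𝓞 K) ∈ v.asIdeal →
          (((p : ℤ) ^ Nv i) • cs i ∈
              (W.baseChange K).torsionLocalKer (v.adicCompletion K) ((p ^ M : ℕ) : ℤ) ∧
            (Nv i ≠ 0 → ((p : ℤ) ^ (Nv i - 1)) • cs i ∉
              (W.baseChange K).torsionLocalKer (v.adicCompletion K) ((p ^ M : ℕ) : ℤ)))) :
    ∃ S : HypothesesM (galH1Torsion (W.baseChange K) ((p ^ M : ℕ) : ℤ))
        (HeightOneSpectrum (𝓞 K) ⊕ InfinitePlace K),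
      S.Sel = selmerGroup (W.baseChange K) ((p ^ M : ℕ) : ℤ) ∧
      S.x = kummerMapTorsion (W.baseChange K) _ hdiv x₀ ∧ S.p = p ∧ S.M₀ = M₀ ∧ S.M = M := by
  have hn0 : ((p ^ M : ℕ) : ℤ) ≠ 0 := by exact_mod_cast pow_ne_zero M hp.ne_zero
  -- `τ x = ε x`
  set x := kummerMapTorsion (W.baseChange K) _ hdiv x₀ with hxdef
  have hεε : ε * ε = 1 := by rcases hε with rfl | rfl <;> norm_num
  have hτx : conjAct W c _ x = ε • x := by
    rw [hxdef, conjAct_kummerMapTorsion W c _ hdiv x₀]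
    -- `t = c x₀ - ε x₀` is torsion
    set t := Affine.Point.map (W' := W) (c : K →ₐ[ℚ] K) x₀ - ε • x₀ with ht
    have htP : p ^ M₀ • t = Affine.Point.map (W' := W) (c : K →ₐ[ℚ] K) P - ε • P := by
      rw [ht, smul_sub, ← map_nsmul, hx₀, smul_comm, hx₀]
    have htors : IsOfFinAddOrder t := by
      obtain ⟨k, hk, hkt⟩ := (isOfFinAddOrder_iff_nsmul_eq_zero).mp h53
      refine (isOfFinAddOrder_iff_nsmul_eq_zero).mpr ⟨k * p ^ M₀, Nat.mul_pos hk (pow_pos hp.pos _), ?_⟩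
      rw [mul_smul, htP, hkt]
    obtain ⟨s, hs⟩ := exists_pow_smul_eq_of_isOfFinAddOrder hp hA htors M
    have hker : t ∈ (kummerMapTorsion (W.baseChange K) ((p ^ M : ℕ) : ℤ) hdiv).ker := by
      rw [kummerMapTorsion_ker]
      exact ⟨s, by rw [← hs, Nat.cast_pow]; rfl⟩
    have ht0 : kummerMapTorsion (W.baseChange K) _ hdiv t = 0 := hker
    have : Affine.Point.map (W' := W) (c : K →ₐ[ℚ] K) x₀ = t + ε • x₀ := by rw [ht]; abel
    rw [this, map_add, ht0, zero_add, map_zsmul]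
  -- the local conditions at the (complex) infinite places are empty
  have hinf : ∀ (w : InfinitePlace K) (y : galH1Torsion (W.baseChange K) ((p ^ M : ℕ) : ℤ)),
      y ∈ selmerLocalKer (W.baseChange K) w.Completion ((p ^ M : ℕ) : ℤ) := fun w y ↦ by
    haveI : IsAlgClosed w.Completion :=
      isAlgClosed_of_ringEquiv (InfinitePlace.Completion.ringEquivComplexOfIsComplex
        (hK.2.isComplex w)).symm
    rw [WeierstrassCurve.selmerLocalKer_eq_top_of_isAlgClosed]
    trivial
  -- the structure
  refine ⟨
    { p := p
      hp := hp
      hp2 := hp2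
      M := M
      torsion := fun v ↦ by
        have := zsmul_discreteH1_torsion ((p ^ M : ℕ) : ℤ) v
        exact_mod_cast this
      τ := conjAct W c _
      τ_τ := conjAct_conjAct_of_mul_self W hcc _
      Sel := selmerGroup (W.baseChange K) _
      τ_mem := fun s hs ↦ conjAct_mem_selmerGroup W hK.2.isComplex c _ hs
      Loc := Sum.elim (fun v ↦ selmerLocalKer (W.baseChange K) (v.adicCompletion K) _)
        (fun w ↦ selmerLocalKer (W.baseChange K) w.Completion _)
      mem_sel_iff := fun s ↦ by rw [mem_selmerGroup_iff, Sum.forall]; rfl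
      Kol := fun ℓ ↦ IsKolyvaginPrime N W K p ℓ ∧ FrobEqFrobInfty W K (p ^ M) ℓ
      prime_of_kol := fun ℓ h ↦ h.1.prime
      pl := fun ℓ ↦ if h : IsKolyvaginPrime N W K p ℓ ∧ FrobEqFrobInfty W K (p ^ M) ℓ then
          Sum.inl h.1.place else Sum.inr (Classical.arbitrary _)
      Dv := fun v n ↦ Sum.elim (fun v ↦ (n : 𝓞 K) ∈ v.asIdeal) (fun _ ↦ False) v
      dv_iff := fun ℓ hℓ v ↦ by
        rw [dif_pos hℓ]
        rcases v with v | w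
        · simp only [Sum.elim_inl, Sum.inl.injEq]
          exact hℓ.1.mem_iff
        · simp
      dv_mul := fun ℓ ℓ' _ _ v ↦ by
        rcases v with v | w
        · exact natCast_mul_mem_asIdeal
        · simp
      A := fun ℓ ↦ ⨅ (v : HeightOneSpectrum (𝓞 K)) (_ : (ℓ : 𝓞 K) ∈ v.asIdeal),
        (W.baseChange K).torsionLocalKer (v.adicCompletion K) _
      x := x
      x_mem := (mem_selmerGroup_iff _ _ _).mpr
        ⟨fun _ ↦ kummerMapTorsion_mem_selmerLocalKer _ _ _ _ x₀,
          fun _ ↦ kummerMapTorsion_mem_selmerLocalKer _ _ _ _ x₀⟩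
      x_ord := hxord
      M₀ := M₀
      ε := ε
      hε := hε
      τ_x := hτx
      c := cl
      c_one := by rw [hc1, hPx]
      τ_c := fun n hn ↦ (hcl n hn.1 hn.2).1
      c_mem_loc := fun n hn v hv ↦ by
        rcases v with v | w
        · exact (hcl n hn.1 hn.2).2.1 v hv
        · exact hinf w (cl n)
      c_mem_loc_iff := fun ℓ m hℓ hn a ↦ by
        rw [dif_pos hℓ]
        simp only [Sum.elim_inl, AddSubgroup.mem_iInf]
        have key := (hcl (ℓ * m) hn.1 hn.2).2.2 ℓ hℓ.1.prime (dvd_mul_right ℓ m) hℓ.1.place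
          hℓ.1.mem_place a
        rw [Nat.mul_div_cancel_left m hℓ.1.prime.pos] at key
        rw [key]
        constructor
        · intro h v hv
          rwa [hℓ.1.mem_iff.mp hv]
        · intro h
          exact h hℓ.1.place hℓ.1.mem_place
      duality := fun ℓ hℓ ν hν d hd hoff s hs hτs a ha hat ↦ by
        rw [dif_pos hℓ] at hoff hat
        simp only [AddSubgroup.mem_iInf]
        intro v hv
        refine hdual ℓ hℓ ν hν d hd (fun v' hv' ↦ ?_) (fun w ↦ ?_) s hs hτs a ha v hv ?_
        · exact hoff (Sum.inl v') (fun h ↦ hv' (hℓ.1.mem_iff.mpr (Sum.inl_injective h)))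
        · exact hoff (Sum.inr w) (by simp)
        · rwa [hℓ.1.mem_iff.mp hv]
      cebotarev := fun r cs Nv h0 hN hτ hind b ↦ by
        obtain ⟨ℓ, hlt, hKol, hfrob, hloc⟩ := hceb r cs Nv h0 hN hτ hind b
        refine ⟨ℓ, hlt, ⟨hKol, hfrob⟩, fun i ↦ ⟨?_, fun hNi h ↦ ?_⟩⟩
        · simp only [AddSubgroup.mem_iInf]
          intro v hv
          exact (hloc i v hv).1
        · simp only [AddSubgroup.mem_iInf] at h
          exact (hloc i hKol.place hKol.mem_place).2 hNi (h hKol.place hKol.mem_place) },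
    rfl, rfl, rfl, rfl, rfl⟩

end LocalDataM

end KolyvaginDescent

/-! ## The leaf from descent data in the excluded cases -/

section Exceptional

variable (N : ℕ) [NeZero N] (W : WeierstrassCurve ℚ) (K : Type u) [Field K] [NumberField K]

/-- **`Kolyvagin1990_thmA_of_hasCM_or_discr` from Kolyvagin's descent data modulo `p^M`** (the
CM-capable interface; no hypothesis on `End(E)`, `d_K` or `ρ̄_{E,p}`, and no reference to the
`p`-primary leaf). In the excluded cases (`E` with CM, or `d_K ∈ {-3, -4}`), whenever the Heegner
point `P = y_K` has infinite order, suppose given a finite residual set of primes `R`, for every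
prime `p ∉ R` the data `HypothesesM` on `H¹(K, E[p^j])` for all `j ≥ 1` (McCallum 1991, §§3–5
modulo `p^j`: Kolyvagin's classes, local duality, Cor. 3.2) with `p^{M₀} x₀ = y_K`,
`Sel = S_{p^j}(E/K)`, `x ∈ δ(E(K))`, and for `p ∈ R` the finiteness of `Ш(E/K)[p^∞]` (Kolyvagin
1990 [K1] at the finitely many inadmissible primes). Then `rank E(K) = 1` and `Ш(E/K)` is
finite (`WeierstrassCurve.mordellWeilRank_eq_one_and_shaFinite_of_hypothesesM`).
[cite: McCallumLMS1991, §1 Theorem (Kolyvagin), §5] [cite: GrossLMS1991, §1 Thm. 1.3, §2] -/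
theorem Kolyvagin1990_thmA_of_hasCM_or_discr_of_hypothesesM
    (h : ∀ [W.IsElliptic]
      (_hexc : W.HasCM ∨ NumberField.discr K = -3 ∨ NumberField.discr K = -4)
      (_hK : IsImaginaryQuadratic K) (_hH : SatisfiesHeegnerHypothesis N K)
      {P : (W.baseChange K).toAffine.Point} (_hP : IsHeegnerPoint N W K P)
      (_hnt : ¬ IsOfFinAddOrder P),
      ∃ R : ℕ → Prop, (∃ B : ℕ, ∀ p : ℕ, p.Prime → B ≤ p → ¬ R p) ∧
        (∀ p : ℕ, p.Prime → ¬ R p →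
          ∃ (M₀ : ℕ) (x₀ : (W.baseChange K).toAffine.Point)
            (T : ∀ j : ℕ, 1 ≤ j →
              HypothesesM (galH1Torsion (W.baseChange K) ((p ^ j : ℕ) : ℤ))
                (HeightOneSpectrum (𝓞 K) ⊕ InfinitePlace K)),
            p ^ M₀ • x₀ = P ∧ ∀ (j : ℕ) (hj : 1 ≤ j), (T j hj).p = p ∧ (T j hj).M₀ = M₀ ∧
              (T j hj).M = j ∧ (T j hj).Sel = selmerGroup (W.baseChange K) ((p ^ j : ℕ) : ℤ) ∧
              (T j hj).x ∈ (torsionH1ToH1 (W.baseChange K) ((p ^ j : ℕ) : ℤ)).ker) ∧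
        (∀ p : ℕ, p.Prime → R p →
          Set.Finite {c : (W.baseChange K).sha | ∃ j : ℕ, p ^ j • c = 0})) :
    Kolyvagin1990_thmA_of_hasCM_or_discr N W K := by
  intro _ hexc hK hH P hP hnt
  haveI : (W.baseChange K).IsElliptic := inferInstanceAs (W.map (algebraMap ℚ K)).IsElliptic
  obtain ⟨R, hR, hdata, hres⟩ := h hexc hK hH hP hnt
  exact (W.baseChange K).mordellWeilRank_eq_one_and_shaFinite_of_hypothesesM hnt hR hdata hres

/-- No prime `p ≥ 9` divides `2 d_K` when `d_K ∈ {-3, -4}`. [folklore] -/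
private theorem not_dvd_two_mul_discr_of_le
    (hD : NumberField.discr K = -3 ∨ NumberField.discr K = -4) {p : ℕ} (hp : 9 ≤ p) :
    ¬ (p : ℤ) ∣ 2 * NumberField.discr K := by
  rintro ⟨k, hk⟩
  rcases hD with h | h <;> rw [h] at hk
  · have h6 : (p : ℤ) ∣ 6 := ⟨-k, by linarith⟩
    have := Int.le_of_dvd (by norm_num) h6
    omega
  · have h8 : (p : ℤ) ∣ 8 := ⟨-k, by linarith⟩
    have := Int.le_of_dvd (by norm_num) h8
    omega

/-- **The sub-case `E` without CM, `d_K ∈ {-3, -4}`, from exactly the inputs of the main case.**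
`Kolyvagin1990_thmA_of_hasCM_or_discr N W K` holds for a curve `E = W` without complex
multiplication (so that only `K = ℚ(√-3), ℚ(i)` remain of the leaf's hypothesis) as soon as:
* `hSerre`, `hC`, `hW`: Serre's open image theorem (`serre_open_image`), the Čebotarev density
  theorem (`Automorphic.chebotarev_artinRep`) and the Weil pairing on `E[p]`
  (`WeierstrassCurve.exists_weilPairing`) — named facts of the tree, as in the main case;
* `hleaves`: for `d_K ∈ {-3, -4}`, every prime `p ∤ 2d_K` (odd and prime to
  `u_K = #𝒪_K^×/2 ∈ {3, 2}`) with `ρ̄_{E,p}` onto, every level `M ≥ 1` and the complex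
  conjugation `c`: Kolyvagin's classes `c_M(n) ∈ H¹(K, E_{p^M})` over the square-free products of
  Kolyvagin primes of level `M`, with McCallum's (6) at `n = 1`, Lemma 4.3, Prop. 4.4 and Gross's
  Props. 5.3, 5.4 (2) (leaf **(A)**), and McCallum's Lemma 5.3 with Prop. 2.2 (local Tate duality
  at `λ` and the reciprocity law, leaf **(B)**) — *verbatim the hypothesis `hleaves` of
  `Kolyvagin1990_sha_primary_finite_of_leavesM`* (the main case of the `p`-primary leaf) with
  `d_K ∉ {-3, -4}` replaced by `d_K ∈ {-3, -4}` and `p ≠ 2` by `p ∤ 2d_K` (over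
  `K = ℚ(√-3), ℚ(i)` the ring class groups `G_ℓ` have order `(ℓ + 1)/u_K`, Gross 1991, §3, and
  the classes exist for `p ∤ u_K`; [K1]);
* `hK1`: the finiteness of `Ш(E/K)[p^∞]` at the residual primes `p ∣ 2d_K` or `ρ̄_{E,p}` not onto
  — Kolyvagin 1990 [K1], Thm. A with Serre's bounded-index theorem (Gross 1991, §2, last
  paragraph), not in the tree.
Proof: the residual set is finite by Serre's theorem; off it, `E(K)[p] = 0`
(`torsionBy_eq_bot_of_isImaginaryQuadratic`), `M₀` and `x₀` come from McCallum's Lemma 5.1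
(`exists_kummer_generator_pow`), the data at every level from `exists_hypothesesM_of_leavesM`
(where McCallum's Cor. 3.2 at level `p^M` is the theorem `McCallum1991_cor_3_2_pow_of_chebotarev`),
and `Kolyvagin1990_thmA_of_hasCM_or_discr_of_hypothesesM` concludes. This supersedes
`Kolyvagin1990_thmA_of_hasCM_or_discr_of_localData_of_not_hasCM` (which still invoked the
`p`-primary leaf). [cite: McCallumLMS1991, §1 Theorem (Kolyvagin), §§3–5]
[cite: GrossLMS1991, §1 (D ≠ 3, 4), §2, §3] [cite: Serre1972, §4.2 Thm. 2] -/
theorem Kolyvagin1990_thmA_of_hasCM_or_discr_of_leavesM_of_not_hasCM (hE : ¬ W.HasCM)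
    (hSerre : serre_open_image) (hC : Automorphic.chebotarev_artinRep)
    (hW : ∀ p : ℕ, p.Prime → W.exists_weilPairing p)
    (hleaves : ∀ [W.IsElliptic] (_hK : IsImaginaryQuadratic K)
      (_hD : NumberField.discr K = -3 ∨ NumberField.discr K = -4)
      (_hH : SatisfiesHeegnerHypothesis N K)
      {P : (W.baseChange K).toAffine.Point} (_hP : IsHeegnerPoint N W K P)
      (_hnt : ¬ IsOfFinAddOrder P) {p : ℕ} (_hp : p.Prime)
      (_hpD : ¬ (p : ℤ) ∣ 2 * NumberField.discr K)
      (_hρ : W.HasSurjectiveModNGaloisRep p) {M : ℕ} (_hM : 1 ≤ M)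
      (hdiv : ∀ Q : geomPoints (W.baseChange K), ∃ R, ((p ^ M : ℕ) : ℤ) • R = Q)
      (c : K ≃ₐ[ℚ] K) (_hc : c ≠ 1),
      ∃ (ε : ℤ) (cl : ℕ → galH1Torsion (W.baseChange K) ((p ^ M : ℕ) : ℤ)),
        (ε = 1 ∨ ε = -1) ∧
        IsOfFinAddOrder (Affine.Point.map (W' := W) (c : K →ₐ[ℚ] K) P - ε • P) ∧
        cl 1 = kummerMapTorsion (W.baseChange K) _ hdiv P ∧
        (∀ m : ℕ, Squarefree m →
          (∀ q ∈ m.primeFactors, IsKolyvaginPrime N W K p q ∧ FrobEqFrobInfty W K (p ^ M) q) →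
          conjAct W c _ (cl m) = (ε * (-1) ^ m.primeFactors.card) • cl m ∧
          (∀ v : HeightOneSpectrum (𝓞 K), (m : 𝓞 K) ∉ v.asIdeal →
            cl m ∈ selmerLocalKer (W.baseChange K) (v.adicCompletion K) ((p ^ M : ℕ) : ℤ)) ∧
          (∀ ℓ : ℕ, ℓ.Prime → ℓ ∣ m → ∀ v : HeightOneSpectrum (𝓞 K), (ℓ : 𝓞 K) ∈ v.asIdeal →
            ∀ a : ℕ, (((p : ℤ) ^ a) • cl m ∈
                selmerLocalKer (W.baseChange K) (v.adicCompletion K) ((p ^ M : ℕ) : ℤ) ↔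
              ((p : ℤ) ^ a) • cl (m / ℓ) ∈
                (W.baseChange K).torsionLocalKer (v.adicCompletion K) ((p ^ M : ℕ) : ℤ)))) ∧
        (∀ ℓ : ℕ, IsKolyvaginPrime N W K p ℓ ∧ FrobEqFrobInfty W K (p ^ M) ℓ →
          ∀ ν : ℤ, (ν = 1 ∨ ν = -1) → ∀ d : galH1Torsion (W.baseChange K) ((p ^ M : ℕ) : ℤ),
          conjAct W c _ d = ν • d →
          (∀ v : HeightOneSpectrum (𝓞 K), (ℓ : 𝓞 K) ∉ v.asIdeal →
            d ∈ selmerLocalKer (W.baseChange K) (v.adicCompletion K) ((p ^ M : ℕ) : ℤ)) →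
          (∀ w : InfinitePlace K,
            d ∈ selmerLocalKer (W.baseChange K) w.Completion ((p ^ M : ℕ) : ℤ)) →
          ∀ s ∈ selmerGroup (W.baseChange K) ((p ^ M : ℕ) : ℤ), conjAct W c _ s = ν • s →
          ∀ a : ℕ, a < M → ∀ v : HeightOneSpectrum (𝓞 K), (ℓ : 𝓞 K) ∈ v.asIdeal →
            ((p : ℤ) ^ a) • d ∉
              selmerLocalKer (W.baseChange K) (v.adicCompletion K) ((p ^ M : ℕ) : ℤ) →
            ((p : ℤ) ^ (M - 1 - a)) • s ∈
              (W.baseChange K).torsionLocalKer (v.adicCompletion K) ((p ^ M : ℕ) : ℤ)))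
    (hK1 : ∀ [W.IsElliptic] (_hK : IsImaginaryQuadratic K)
      (_hD : NumberField.discr K = -3 ∨ NumberField.discr K = -4)
      (_hH : SatisfiesHeegnerHypothesis N K) {P : (W.baseChange K).toAffine.Point}
      (_hP : IsHeegnerPoint N W K P) (_hnt : ¬ IsOfFinAddOrder P) (p : ℕ) (_hp : p.Prime),
      ((p : ℤ) ∣ 2 * NumberField.discr K ∨ ¬ W.HasSurjectiveModNGaloisRep p) →
      Set.Finite {c : (W.baseChange K).sha | ∃ j : ℕ, p ^ j • c = 0}) :
    Kolyvagin1990_thmA_of_hasCM_or_discr N W K := by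
  refine Kolyvagin1990_thmA_of_hasCM_or_discr_of_hypothesesM N W K ?_
  intro _ hexc hK hH P hP hnt
  haveI : (W.baseChange K).IsElliptic := inferInstanceAs (W.map (algebraMap ℚ K)).IsElliptic
  have hD : NumberField.discr K = -3 ∨ NumberField.discr K = -4 := hexc.resolve_left hE
  obtain ⟨c, hc, hcc⟩ := exists_conj_of_isImaginaryQuadratic K hK
  obtain ⟨p₁, hp₁⟩ := hSerre W hE
  refine ⟨fun p ↦ (p : ℤ) ∣ 2 * NumberField.discr K ∨ ¬ W.HasSurjectiveModNGaloisRep p,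
    ⟨max p₁ 9, fun p hp hle ↦ ?_⟩, fun p hp hRp ↦ ?_, fun p hp hRp ↦ hK1 hK hD hH hP hnt p hp hRp⟩
  · -- no residual prime beyond `max p₁ 9`
    show ¬ ((p : ℤ) ∣ 2 * NumberField.discr K ∨ ¬ W.HasSurjectiveModNGaloisRep p)
    rintro (hdvd | hnsurj)
    · exact not_dvd_two_mul_discr_of_le K hD ((le_max_right _ _).trans hle) hdvd
    · exact hnsurj (hp₁ p hp ((le_max_left _ _).trans hle))
  · -- the data at a non-residual prime `p`: `p ∤ 2 d_K`, `ρ̄_{E,p}` onto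
    have hRp' : ¬ (p : ℤ) ∣ 2 * NumberField.discr K ∧ W.HasSurjectiveModNGaloisRep p := by
      simpa only [not_or, not_not] using hRp
    obtain ⟨hpD, hρ⟩ := hRp'
    have hp2 : p ≠ 2 := by
      rintro rfl
      exact hpD (dvd_mul_right 2 _)
    -- `E(K)[p] = 0`, `M₀`, `x₀`
    have hbot := torsionBy_eq_bot_of_isImaginaryQuadratic W K hK hp hp2 hρ
    have hA : ∀ a : (W.baseChange K).toAffine.Point, p • a = 0 → a = 0 := fun a ha ↦ by
      have : a ∈ AddSubgroup.torsionBy (W.baseChange K).toAffine.Point (p : ℤ) := by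
        rw [mem_torsionBy_iff, natCast_zsmul]; exact ha
      rw [hbot] at this
      exact this
    obtain ⟨M₀, x₀, hx₀, -, hgen⟩ := exists_kummer_generator_pow (W.baseChange K) hp hA hnt
    have hdivj : ∀ j : ℕ, ∀ Q : geomPoints (W.baseChange K), ∃ R, ((p ^ j : ℕ) : ℤ) • R = Q :=
      fun j ↦ (W.baseChange K).zsmul_geomPoints_surjective_holds
        (by exact_mod_cast pow_ne_zero j hp.ne_zero)
    have key : ∀ j : ℕ, 1 ≤ j →
        ∃ S : HypothesesM (galH1Torsion (W.baseChange K) ((p ^ j : ℕ) : ℤ))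
            (HeightOneSpectrum (𝓞 K) ⊕ InfinitePlace K),
          S.Sel = selmerGroup (W.baseChange K) ((p ^ j : ℕ) : ℤ) ∧
          S.x = kummerMapTorsion (W.baseChange K) _ (hdivj j) x₀ ∧ S.p = p ∧ S.M₀ = M₀ ∧
          S.M = j := by
      intro j hj
      obtain ⟨ε, cl, hε, h53, hc1, hcl, hdual⟩ :=
        hleaves hK hD hH hP hnt hp hpD hρ hj (hdivj j) c hc
      obtain ⟨hPx, hxord⟩ := hgen j (by omega) (hdivj j)
      exact exists_hypothesesM_of_leavesM (N := N) hK hp hp2 hρ hC (hW p hp) hj (hdivj j) hc hcc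
        hx₀ hPx hxord ε hε h53 cl hc1 hcl hdual
    choose T hT using key
    refine ⟨M₀, x₀, T, hx₀, fun j hj ↦
      ⟨(hT j hj).2.2.1, (hT j hj).2.2.2.1, (hT j hj).2.2.2.2, (hT j hj).1, ?_⟩⟩
    rw [(hT j hj).2.1, AddMonoidHom.mem_ker]
    exact torsionH1ToH1_kummerMapTorsion _ _ _ x₀


/-- **`Kolyvagin1990_thmA_of_hasCM_or_discr` from the per-prime bodies (A), (B), (C) modulo
`p^M` and [K1] at the residual primes — the CM-capable form.** In the excluded cases, whenever
the Heegner point `P = y_K` has infinite order, suppose given a finite (bounded) residual set of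
primes `R` and, for every prime `p ∉ R`: `p ≠ 2`, `E(K)[p] = 0`, and for every level `M ≥ 1` and
the complex conjugation `c`, McCallum's Cor. 3.2 for `H¹(K, E_{p^M})` (**(C)**, hypothesis in the
shape of the `cebotarev` field; for `E` without CM and `ρ̄_{E,p}` onto it is the theorem
`McCallum1991_cor_3_2_pow_of_chebotarev`, for `E` with CM by `R ⊂ F` it is to be proved for the
image `Gal(F(E_p)/F) = Aut_R(E_p)`, McCallum 1991, §1 and §3), Kolyvagin's classes `c_M(n)` with
McCallum's (6), Lemma 4.3, Prop. 4.4 and Gross's Props. 5.3, 5.4 (2) (**(A)**) and McCallum's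
Lemma 5.3 with Prop. 2.2 (**(B)**) — the bodies of the two leaves of
`exists_hypothesesM_of_leavesM`; and for `p ∈ R` the finiteness of `Ш(E/K)[p^∞]` (Kolyvagin
1990 [K1] at the inadmissible primes: `p = 2`, `p` ramified in `F`, small image). Then
`rank E(K) = 1` and `Ш(E/K)` is finite: `M₀`, `x₀` from McCallum's Lemma 5.1
(`exists_kummer_generator_pow`), the data at every level from `exists_hypothesesM_of_localDataM`,
and `Kolyvagin1990_thmA_of_hasCM_or_discr_of_hypothesesM`.
[cite: McCallumLMS1991, §1 Theorem (Kolyvagin), §3 Cor. 3.2, §§4–5]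
[cite: GrossLMS1991, §1 Thm. 1.3, §2, Props. 5.3, 5.4 (2)] -/
theorem Kolyvagin1990_thmA_of_hasCM_or_discr_of_localDataM
    (h : ∀ [W.IsElliptic]
      (_hexc : W.HasCM ∨ NumberField.discr K = -3 ∨ NumberField.discr K = -4)
      (_hK : IsImaginaryQuadratic K) (_hH : SatisfiesHeegnerHypothesis N K)
      {P : (W.baseChange K).toAffine.Point} (_hP : IsHeegnerPoint N W K P)
      (_hnt : ¬ IsOfFinAddOrder P),
      ∃ R : ℕ → Prop, (∃ B : ℕ, ∀ p : ℕ, p.Prime → B ≤ p → ¬ R p) ∧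
        (∀ (p : ℕ) (_hp : p.Prime) (_hRp : ¬ R p), p ≠ 2 ∧
          AddSubgroup.torsionBy (W.baseChange K).toAffine.Point (p : ℤ) = ⊥ ∧
          ∀ (M : ℕ) (_hM : 1 ≤ M)
            (hdiv : ∀ Q : geomPoints (W.baseChange K), ∃ R', ((p ^ M : ℕ) : ℤ) • R' = Q)
            (c : K ≃ₐ[ℚ] K) (_hc : c ≠ 1),
            (∀ (r : ℕ) (cs : Fin r → galH1Torsion (W.baseChange K) ((p ^ M : ℕ) : ℤ))
              (Nv : Fin r → ℕ), (∀ i, cs i ≠ 0) →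
              (∀ i, Nv i ≠ 0 → ((p : ℤ) ^ (Nv i - 1)) • cs i ≠ 0) →
              (∀ i, ∃ e : ℤ, (e = 1 ∨ e = -1) ∧
                conjAct W c ((p ^ M : ℕ) : ℤ) (cs i) = e • cs i) →
              (∀ a : Fin r → ℤ, ∑ i, a i • cs i = 0 → ∀ i, a i • cs i = 0) →
              ∀ b : ℕ, ∃ ℓ : ℕ, b < ℓ ∧ IsKolyvaginPrime N W K p ℓ ∧
                FrobEqFrobInfty W K (p ^ M) ℓ ∧
                ∀ i, ∀ v : HeightOneSpectrum (𝓞 K), (ℓ : 𝓞 K) ∈ v.asIdeal →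
                  (((p : ℤ) ^ Nv i) • cs i ∈
                      (W.baseChange K).torsionLocalKer (v.adicCompletion K) ((p ^ M : ℕ) : ℤ) ∧
                    (Nv i ≠ 0 → ((p : ℤ) ^ (Nv i - 1)) • cs i ∉
                      (W.baseChange K).torsionLocalKer (v.adicCompletion K)
                        ((p ^ M : ℕ) : ℤ)))) ∧
            ∃ (ε : ℤ) (cl : ℕ → galH1Torsion (W.baseChange K) ((p ^ M : ℕ) : ℤ)),
              (ε = 1 ∨ ε = -1) ∧
              IsOfFinAddOrder (Affine.Point.map (W' := W) (c : K →ₐ[ℚ] K) P - ε • P) ∧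
              cl 1 = kummerMapTorsion (W.baseChange K) _ hdiv P ∧
              (∀ m : ℕ, Squarefree m →
                (∀ q ∈ m.primeFactors,
                  IsKolyvaginPrime N W K p q ∧ FrobEqFrobInfty W K (p ^ M) q) →
                conjAct W c _ (cl m) = (ε * (-1) ^ m.primeFactors.card) • cl m ∧
                (∀ v : HeightOneSpectrum (𝓞 K), (m : 𝓞 K) ∉ v.asIdeal →
                  cl m ∈ selmerLocalKer (W.baseChange K) (v.adicCompletion K)
                    ((p ^ M : ℕ) : ℤ)) ∧
                (∀ ℓ : ℕ, ℓ.Prime → ℓ ∣ m → ∀ v : HeightOneSpectrum (𝓞 K),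
                  (ℓ : 𝓞 K) ∈ v.asIdeal →
                  ∀ a : ℕ, (((p : ℤ) ^ a) • cl m ∈
                      selmerLocalKer (W.baseChange K) (v.adicCompletion K) ((p ^ M : ℕ) : ℤ) ↔
                    ((p : ℤ) ^ a) • cl (m / ℓ) ∈
                      (W.baseChange K).torsionLocalKer (v.adicCompletion K)
                        ((p ^ M : ℕ) : ℤ)))) ∧
              (∀ ℓ : ℕ, IsKolyvaginPrime N W K p ℓ ∧ FrobEqFrobInfty W K (p ^ M) ℓ →
                ∀ ν : ℤ, (ν = 1 ∨ ν = -1) →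
                ∀ d : galH1Torsion (W.baseChange K) ((p ^ M : ℕ) : ℤ),
                conjAct W c _ d = ν • d →
                (∀ v : HeightOneSpectrum (𝓞 K), (ℓ : 𝓞 K) ∉ v.asIdeal →
                  d ∈ selmerLocalKer (W.baseChange K) (v.adicCompletion K) ((p ^ M : ℕ) : ℤ)) →
                (∀ w : InfinitePlace K,
                  d ∈ selmerLocalKer (W.baseChange K) w.Completion ((p ^ M : ℕ) : ℤ)) →
                ∀ s ∈ selmerGroup (W.baseChange K) ((p ^ M : ℕ) : ℤ), conjAct W c _ s = ν • s →
                ∀ a : ℕ, a < M → ∀ v : HeightOneSpectrum (𝓞 K), (ℓ : 𝓞 K) ∈ v.asIdeal →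
                  ((p : ℤ) ^ a) • d ∉
                    selmerLocalKer (W.baseChange K) (v.adicCompletion K) ((p ^ M : ℕ) : ℤ) →
                  ((p : ℤ) ^ (M - 1 - a)) • s ∈
                    (W.baseChange K).torsionLocalKer (v.adicCompletion K) ((p ^ M : ℕ) : ℤ))) ∧
        (∀ p : ℕ, p.Prime → R p →
          Set.Finite {c : (W.baseChange K).sha | ∃ j : ℕ, p ^ j • c = 0})) :
    Kolyvagin1990_thmA_of_hasCM_or_discr N W K := by
  refine Kolyvagin1990_thmA_of_hasCM_or_discr_of_hypothesesM N W K ?_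
  intro _ hexc hK hH P hP hnt
  haveI : (W.baseChange K).IsElliptic := inferInstanceAs (W.map (algebraMap ℚ K)).IsElliptic
  obtain ⟨R, hR, hdata, hres⟩ := h hexc hK hH hP hnt
  obtain ⟨c, hc, hcc⟩ := exists_conj_of_isImaginaryQuadratic K hK
  refine ⟨R, hR, fun p hp hRp ↦ ?_, hres⟩
  obtain ⟨hp2, hbot, hlev⟩ := hdata p hp hRp
  have hA : ∀ a : (W.baseChange K).toAffine.Point, p • a = 0 → a = 0 := fun a ha ↦ by
    have : a ∈ AddSubgroup.torsionBy (W.baseChange K).toAffine.Point (p : ℤ) := by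
      rw [mem_torsionBy_iff, natCast_zsmul]; exact ha
    rw [hbot] at this
    exact this
  obtain ⟨M₀, x₀, hx₀, -, hgen⟩ := exists_kummer_generator_pow (W.baseChange K) hp hA hnt
  have hdivj : ∀ j : ℕ, ∀ Q : geomPoints (W.baseChange K), ∃ R', ((p ^ j : ℕ) : ℤ) • R' = Q :=
    fun j ↦ (W.baseChange K).zsmul_geomPoints_surjective_holds
      (by exact_mod_cast pow_ne_zero j hp.ne_zero)
  have key : ∀ j : ℕ, 1 ≤ j →
      ∃ S : HypothesesM (galH1Torsion (W.baseChange K) ((p ^ j : ℕ) : ℤ))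
          (HeightOneSpectrum (𝓞 K) ⊕ InfinitePlace K),
        S.Sel = selmerGroup (W.baseChange K) ((p ^ j : ℕ) : ℤ) ∧
        S.x = kummerMapTorsion (W.baseChange K) _ (hdivj j) x₀ ∧ S.p = p ∧ S.M₀ = M₀ ∧
        S.M = j := by
    intro j hj
    obtain ⟨hceb, ε, cl, hε, h53, hc1, hcl, hdual⟩ := hlev j hj (hdivj j) c hc
    obtain ⟨hPx, hxord⟩ := hgen j (by omega) (hdivj j)
    exact exists_hypothesesM_of_localDataM (N := N) hK hp hp2 hA (hdivj j) hcc hx₀ hPx hxord ε hε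
      h53 cl hc1 hcl hdual hceb
  choose T hT using key
  refine ⟨M₀, x₀, T, hx₀, fun j hj ↦
    ⟨(hT j hj).2.2.1, (hT j hj).2.2.2.1, (hT j hj).2.2.2.2, (hT j hj).1, ?_⟩⟩
  rw [(hT j hj).2.1, AddMonoidHom.mem_ker]
  exact torsionH1ToH1_kummerMapTorsion _ _ _ x₀


/-- **`Kolyvagin1990_thmA_of_hasCM_or_discr` from the leaves — combined form, listing in one
statement everything the leaf now rests on.** Named facts of the tree: Serre's open image
theorem (`hSerre`), the Čebotarev density theorem (`hC`), the Weil pairing (`hW`). For `E`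
without CM (so `d_K ∈ {-3, -4}`): the two mod-`p^M` Euler-system leaves (A), (B) at the primes
`p ∤ 2d_K` with `ρ̄_{E,p}` onto (`hleaves`, the shape of the main case's
`Kolyvagin1990_sha_primary_finite_of_leavesM`) and Kolyvagin's [K1] at the residual primes
(`hK1`) — `Kolyvagin1990_thmA_of_hasCM_or_discr_of_leavesM_of_not_hasCM`. For `E` with CM: the
bodies (A), (B), (C) off a finite residual set of primes and [K1] on it (`hCM`) —
`Kolyvagin1990_thmA_of_hasCM_or_discr_of_localDataM`. Nothing else: Gross's §10 modulo `p^M`,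
McCallum's Lemma 5.1, Prop. 2.3 ⇒ Prop. 2.1, the passage to `Ш[p^∞]` and to `Ш`, and (for
`E` without CM) Cor. 3.2 at every level are theorems of the tree.
[cite: McCallumLMS1991, §1 Theorem (Kolyvagin), §§3–5] [cite: GrossLMS1991, §1 Thm. 1.3, §2]
[cite: Serre1972, §4.2 Thm. 2] -/
theorem Kolyvagin1990_thmA_of_hasCM_or_discr_of_leavesM
    (hSerre : serre_open_image) (hC : Automorphic.chebotarev_artinRep)
    (hW : ∀ p : ℕ, p.Prime → W.exists_weilPairing p)
    (hleaves : ∀ [W.IsElliptic] (_hE : ¬ W.HasCM) (_hK : IsImaginaryQuadratic K)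
      (_hD : NumberField.discr K = -3 ∨ NumberField.discr K = -4)
      (_hH : SatisfiesHeegnerHypothesis N K)
      {P : (W.baseChange K).toAffine.Point} (_hP : IsHeegnerPoint N W K P)
      (_hnt : ¬ IsOfFinAddOrder P) {p : ℕ} (_hp : p.Prime)
      (_hpD : ¬ (p : ℤ) ∣ 2 * NumberField.discr K)
      (_hρ : W.HasSurjectiveModNGaloisRep p) {M : ℕ} (_hM : 1 ≤ M)
      (hdiv : ∀ Q : geomPoints (W.baseChange K), ∃ R, ((p ^ M : ℕ) : ℤ) • R = Q)
      (c : K ≃ₐ[ℚ] K) (_hc : c ≠ 1),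
      ∃ (ε : ℤ) (cl : ℕ → galH1Torsion (W.baseChange K) ((p ^ M : ℕ) : ℤ)),
        (ε = 1 ∨ ε = -1) ∧
        IsOfFinAddOrder (Affine.Point.map (W' := W) (c : K →ₐ[ℚ] K) P - ε • P) ∧
        cl 1 = kummerMapTorsion (W.baseChange K) _ hdiv P ∧
        (∀ m : ℕ, Squarefree m →
          (∀ q ∈ m.primeFactors, IsKolyvaginPrime N W K p q ∧ FrobEqFrobInfty W K (p ^ M) q) →
          conjAct W c _ (cl m) = (ε * (-1) ^ m.primeFactors.card) • cl m ∧
          (∀ v : HeightOneSpectrum (𝓞 K), (m : 𝓞 K) ∉ v.asIdeal →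
            cl m ∈ selmerLocalKer (W.baseChange K) (v.adicCompletion K) ((p ^ M : ℕ) : ℤ)) ∧
          (∀ ℓ : ℕ, ℓ.Prime → ℓ ∣ m → ∀ v : HeightOneSpectrum (𝓞 K), (ℓ : 𝓞 K) ∈ v.asIdeal →
            ∀ a : ℕ, (((p : ℤ) ^ a) • cl m ∈
                selmerLocalKer (W.baseChange K) (v.adicCompletion K) ((p ^ M : ℕ) : ℤ) ↔
              ((p : ℤ) ^ a) • cl (m / ℓ) ∈
                (W.baseChange K).torsionLocalKer (v.adicCompletion K) ((p ^ M : ℕ) : ℤ)))) ∧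
        (∀ ℓ : ℕ, IsKolyvaginPrime N W K p ℓ ∧ FrobEqFrobInfty W K (p ^ M) ℓ →
          ∀ ν : ℤ, (ν = 1 ∨ ν = -1) → ∀ d : galH1Torsion (W.baseChange K) ((p ^ M : ℕ) : ℤ),
          conjAct W c _ d = ν • d →
          (∀ v : HeightOneSpectrum (𝓞 K), (ℓ : 𝓞 K) ∉ v.asIdeal →
            d ∈ selmerLocalKer (W.baseChange K) (v.adicCompletion K) ((p ^ M : ℕ) : ℤ)) →
          (∀ w : InfinitePlace K,
            d ∈ selmerLocalKer (W.baseChange K) w.Completion ((p ^ M : ℕ) : ℤ)) →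
          ∀ s ∈ selmerGroup (W.baseChange K) ((p ^ M : ℕ) : ℤ), conjAct W c _ s = ν • s →
          ∀ a : ℕ, a < M → ∀ v : HeightOneSpectrum (𝓞 K), (ℓ : 𝓞 K) ∈ v.asIdeal →
            ((p : ℤ) ^ a) • d ∉
              selmerLocalKer (W.baseChange K) (v.adicCompletion K) ((p ^ M : ℕ) : ℤ) →
            ((p : ℤ) ^ (M - 1 - a)) • s ∈
              (W.baseChange K).torsionLocalKer (v.adicCompletion K) ((p ^ M : ℕ) : ℤ)))
    (hK1 : ∀ [W.IsElliptic] (_hE : ¬ W.HasCM) (_hK : IsImaginaryQuadratic K)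
      (_hD : NumberField.discr K = -3 ∨ NumberField.discr K = -4)
      (_hH : SatisfiesHeegnerHypothesis N K) {P : (W.baseChange K).toAffine.Point}
      (_hP : IsHeegnerPoint N W K P) (_hnt : ¬ IsOfFinAddOrder P) (p : ℕ) (_hp : p.Prime),
      ((p : ℤ) ∣ 2 * NumberField.discr K ∨ ¬ W.HasSurjectiveModNGaloisRep p) →
      Set.Finite {c : (W.baseChange K).sha | ∃ j : ℕ, p ^ j • c = 0})
    (hCM : ∀ [W.IsElliptic] (_hE : W.HasCM)
      (_hK : IsImaginaryQuadratic K) (_hH : SatisfiesHeegnerHypothesis N K)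
      {P : (W.baseChange K).toAffine.Point} (_hP : IsHeegnerPoint N W K P)
      (_hnt : ¬ IsOfFinAddOrder P),
      ∃ R : ℕ → Prop, (∃ B : ℕ, ∀ p : ℕ, p.Prime → B ≤ p → ¬ R p) ∧
        (∀ (p : ℕ) (_hp : p.Prime) (_hRp : ¬ R p), p ≠ 2 ∧
          AddSubgroup.torsionBy (W.baseChange K).toAffine.Point (p : ℤ) = ⊥ ∧
          ∀ (M : ℕ) (_hM : 1 ≤ M)
            (hdiv : ∀ Q : geomPoints (W.baseChange K), ∃ R', ((p ^ M : ℕ) : ℤ) • R' = Q)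
            (c : K ≃ₐ[ℚ] K) (_hc : c ≠ 1),
            (∀ (r : ℕ) (cs : Fin r → galH1Torsion (W.baseChange K) ((p ^ M : ℕ) : ℤ))
              (Nv : Fin r → ℕ), (∀ i, cs i ≠ 0) →
              (∀ i, Nv i ≠ 0 → ((p : ℤ) ^ (Nv i - 1)) • cs i ≠ 0) →
              (∀ i, ∃ e : ℤ, (e = 1 ∨ e = -1) ∧
                conjAct W c ((p ^ M : ℕ) : ℤ) (cs i) = e • cs i) →
              (∀ a : Fin r → ℤ, ∑ i, a i • cs i = 0 → ∀ i, a i • cs i = 0) →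
              ∀ b : ℕ, ∃ ℓ : ℕ, b < ℓ ∧ IsKolyvaginPrime N W K p ℓ ∧
                FrobEqFrobInfty W K (p ^ M) ℓ ∧
                ∀ i, ∀ v : HeightOneSpectrum (𝓞 K), (ℓ : 𝓞 K) ∈ v.asIdeal →
                  (((p : ℤ) ^ Nv i) • cs i ∈
                      (W.baseChange K).torsionLocalKer (v.adicCompletion K) ((p ^ M : ℕ) : ℤ) ∧
                    (Nv i ≠ 0 → ((p : ℤ) ^ (Nv i - 1)) • cs i ∉
                      (W.baseChange K).torsionLocalKer (v.adicCompletion K)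
                        ((p ^ M : ℕ) : ℤ)))) ∧
            ∃ (ε : ℤ) (cl : ℕ → galH1Torsion (W.baseChange K) ((p ^ M : ℕ) : ℤ)),
              (ε = 1 ∨ ε = -1) ∧
              IsOfFinAddOrder (Affine.Point.map (W' := W) (c : K →ₐ[ℚ] K) P - ε • P) ∧
              cl 1 = kummerMapTorsion (W.baseChange K) _ hdiv P ∧
              (∀ m : ℕ, Squarefree m →
                (∀ q ∈ m.primeFactors,
                  IsKolyvaginPrime N W K p q ∧ FrobEqFrobInfty W K (p ^ M) q) →
                conjAct W c _ (cl m) = (ε * (-1) ^ m.primeFactors.card) • cl m ∧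
                (∀ v : HeightOneSpectrum (𝓞 K), (m : 𝓞 K) ∉ v.asIdeal →
                  cl m ∈ selmerLocalKer (W.baseChange K) (v.adicCompletion K)
                    ((p ^ M : ℕ) : ℤ)) ∧
                (∀ ℓ : ℕ, ℓ.Prime → ℓ ∣ m → ∀ v : HeightOneSpectrum (𝓞 K),
                  (ℓ : 𝓞 K) ∈ v.asIdeal →
                  ∀ a : ℕ, (((p : ℤ) ^ a) • cl m ∈
                      selmerLocalKer (W.baseChange K) (v.adicCompletion K) ((p ^ M : ℕ) : ℤ) ↔
                    ((p : ℤ) ^ a) • cl (m / ℓ) ∈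
                      (W.baseChange K).torsionLocalKer (v.adicCompletion K)
                        ((p ^ M : ℕ) : ℤ)))) ∧
              (∀ ℓ : ℕ, IsKolyvaginPrime N W K p ℓ ∧ FrobEqFrobInfty W K (p ^ M) ℓ →
                ∀ ν : ℤ, (ν = 1 ∨ ν = -1) →
                ∀ d : galH1Torsion (W.baseChange K) ((p ^ M : ℕ) : ℤ),
                conjAct W c _ d = ν • d →
                (∀ v : HeightOneSpectrum (𝓞 K), (ℓ : 𝓞 K) ∉ v.asIdeal →
                  d ∈ selmerLocalKer (W.baseChange K) (v.adicCompletion K) ((p ^ M : ℕ) : ℤ)) →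
                (∀ w : InfinitePlace K,
                  d ∈ selmerLocalKer (W.baseChange K) w.Completion ((p ^ M : ℕ) : ℤ)) →
                ∀ s ∈ selmerGroup (W.baseChange K) ((p ^ M : ℕ) : ℤ), conjAct W c _ s = ν • s →
                ∀ a : ℕ, a < M → ∀ v : HeightOneSpectrum (𝓞 K), (ℓ : 𝓞 K) ∈ v.asIdeal →
                  ((p : ℤ) ^ a) • d ∉
                    selmerLocalKer (W.baseChange K) (v.adicCompletion K) ((p ^ M : ℕ) : ℤ) →
                  ((p : ℤ) ^ (M - 1 - a)) • s ∈
                    (W.baseChange K).torsionLocalKer (v.adicCompletion K) ((p ^ M : ℕ) : ℤ))) ∧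
        (∀ p : ℕ, p.Prime → R p →
          Set.Finite {c : (W.baseChange K).sha | ∃ j : ℕ, p ^ j • c = 0})) :
    Kolyvagin1990_thmA_of_hasCM_or_discr N W K := by
  by_cases hE : W.HasCM
  · refine Kolyvagin1990_thmA_of_hasCM_or_discr_of_localDataM N W K ?_
    intro _ _ hK hH P hP hnt
    exact hCM hE hK hH hP hnt
  · refine Kolyvagin1990_thmA_of_hasCM_or_discr_of_leavesM_of_not_hasCM N W K hE hSerre hC hW
      ?_ ?_
    · intro _ hK hD hH P hP hnt p hp hpD hρ M hM hdiv c hc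
      exact hleaves hE hK hD hH hP hnt hp hpD hρ hM hdiv c hc
    · intro _ hK hD hH P hP hnt p hp hres
      exact hK1 hE hK hD hH hP hnt p hp hres

end Exceptional

end Literature.NumberTheory.EllipticCurves

end
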